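import Summits.MatrixMultiplication.OmegaCensus.STPP211TFirstReflectD
import Summits.MatrixMultiplication.OmegaCensus.STPP211TFirstReflectE

/-!
# ω-census, `(2,1,1)^k` T-first kernel engine — reflection F: the T-phase along a canonical `c`-set

HONEST FRAMING (pub-omega census; verbatim): lottery ticket; floor = certified bounds/negative ranges.
Census STRUCTURE bookkeeping of the STPP track (seat pub-omega-stpp-1, gen 38; STRUCTURE row B5, the threshold column
`T1(H) = max {k : (2,1,1)^k ⊆ H}`), not progress on `ω`: small patterns in small groups bound no exponent.

Sixth reflection file for `STPP211TFirstEngine.lean`.  §13 the kernel's `imageMask` is an affine image of codes; §14 the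
prefixes `Ld t j` of a canonical `c`-set (`Canon`) survive every T-level (`tnode_step`, from the prefix lemma and canonicity),
so a `true` frontier from `[0]` lists the depth-`J` prefix (`frontier_mem`) and a `true` search below the roots reaches the
leaf (`tleaf_of_roots`).  The normal form and the theorem through Def. 5.1 are `…ReflectG`.

References: H. Cohn, R. Kleinberg, B. Szegedy, C. Umans, *Group-theoretic algorithms for matrix multiplication*, FOCS 2005
(arXiv:math/0511460), Def. 5.1.  Desk record: pub-omega HOME `pub-omega-stpp-1-g38/`.
-/

namespace Summit.MatrixMultiplication.OmegaCensus

namespace STPP211T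

open STPP211Neg
open Literature.Computability.Complexity (div_mod_block)
open Summit.MatrixMultiplication.OmegaCensus.T1Z2p5 (testBit_lowMask)
open Literature.Barriers.RiemannHypothesis.TuranCheck (beq_true_iff)
open Literature.Computability.AlgebraicComplexity

section TPhase

variable {n K : ℕ} [NeZero n] (units : List ℕ)

/-! ## 13. `imageMask` is an affine image -/

/-- The code map of `x ↦ u (x − a)` as the kernel computes it. -/
def gmap (n a u : ℕ) (t : ℕ) : ℕ := (u * ((t + (n - a)) % n)) % n

omit [NeZero n] in
/-- Bits of `imageMask`: the images of the listed codes. -/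
theorem testBit_imageMask (L : List ℕ) (a u z : ℕ) :
    (imageMask (mkTC n K units) L a u).testBit z = true ↔ ∃ t ∈ L, z = gmap n a u t := by
  induction L with
  | nil => simp [imageMask]
  | cons t tl ih =>
      have : imageMask (mkTC n K units) (t :: tl) a u =
          Nat.lor (imageMask (mkTC n K units) tl a u) (Nat.shiftLeft 1 (gmap n a u t)) := rfl
      rw [this, lor_eq, shiftLeft_eq', Nat.testBit_lor, Nat.one_shiftLeft, Nat.testBit_two_pow, Bool.or_eq_true, ih]
      constructor
      · rintro (⟨t', ht', rfl⟩ | h)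
        · exact ⟨t', by simp [ht'], rfl⟩
        · exact ⟨t, by simp, (of_decide_eq_true h).symm⟩
      · rintro ⟨t', ht', rfl⟩
        rcases List.mem_cons.1 ht' with rfl | ht'
        · right; simp
        · left; exact ⟨t', ht', rfl⟩

/-- On codes of residues, `gmap` is the affine map: `gmap n (y.val) u (x.val) = (u (x − y)).val`. -/
theorem gmap_val (u : ℕ) (x y : ZMod n) : gmap n y.val u x.val = ((u : ZMod n) * (x - y)).val := by
  unfold gmap
  rw [← val_sub_eq, ZMod.val_mul, ZMod.val_natCast, Nat.mul_mod u, Nat.mod_eq_of_lt (ZMod.val_lt (x - y))]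

/-- The image of a code set under `gmap` is the code set of the affine image. -/
theorem image_gmap (u : ℕ) (y : ZMod n) (S : Finset (ZMod n)) :
    (codes S).image (gmap n y.val u) = codes (aff (u : ZMod n) y S) := by
  classical
  unfold codes aff
  rw [Finset.image_image, Finset.image_image]
  congr 1
  funext x
  exact gmap_val u x y

/-! ## 14. The prefixes of a canonical set survive -/

/-- The descending prefix lists `Ld t j = [t (j−1), …, t 0]`. -/
def Ld (t : ℕ → ℕ) : ℕ → List ℕ
  | 0 => []
  | j + 1 => t j :: Ld t j

omit [NeZero n] in
/-- Membership in a prefix list. -/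
theorem mem_Ld (t : ℕ → ℕ) : ∀ j e, e ∈ Ld t j ↔ ∃ i < j, e = t i := by
  intro j
  induction j with
  | zero => simp [Ld]
  | succ j ih =>
      intro e
      simp only [Ld, List.mem_cons, ih]
      constructor
      · rintro (rfl | ⟨i, hi, rfl⟩)
        · exact ⟨j, Nat.lt_succ_self j, rfl⟩
        · exact ⟨i, by omega, rfl⟩
      · rintro ⟨i, hi, rfl⟩
        rcases Nat.lt_succ_iff_lt_or_eq.1 hi with hi | rfl
        · exact Or.inr ⟨i, hi, rfl⟩
        · exact Or.inl rfl

omit [NeZero n] in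
/-- Length of a prefix list. -/
theorem lengthL_Ld (t : ℕ → ℕ) : ∀ j, lengthL (Ld t j) = j := by
  intro j; induction j with
  | zero => rfl
  | succ j ih => show Nat.add (lengthL (Ld t j)) 1 = j + 1; rw [ih]

/-- THE CANONICAL SETTING of the T-phase: a finite `S ⊆ ZMod n` of size `K` containing `0`, canonical in its affine
orbit, enumerated increasingly by `t` on `[0, K)`. -/
structure Canon (n K : ℕ) [NeZero n] (S : Finset (ZMod n)) (t : ℕ → ℕ) : Prop where
  /-- canonical: no unit-affine image is colex-below -/
  can : ∀ (u : (ZMod n)ˣ) (a : ZMod n), ¬ CLTset (codes (aff (u : ZMod n) a S)) (codes S)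
  /-- `t` enumerates the codes … -/ mem : ∀ e, e ∈ codes S ↔ ∃ i < K, e = t i
  /-- … increasingly -/ mono : ∀ i i', i < i' → i' < K → t i < t i'
  /-- `t 0 = 0` -/ zero : t 0 = 0
  /-- `1 ≤ K` -/ pos : 1 ≤ K

variable {S : Finset (ZMod n)} {t : ℕ → ℕ}

/-- Codes are `< n`. -/
theorem Canon.lt (hC : Canon n K S t) {i : ℕ} (hi : i < K) : t i < n := by
  have := (hC.mem (t i)).2 ⟨i, hi, rfl⟩
  unfold codes at this; rw [Finset.mem_image] at this
  obtain ⟨x, -, hx⟩ := this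
  rw [← hx]; exact ZMod.val_lt x

/-- **NO PREFIX OF A CANONICAL SET IS PRUNED.** -/
theorem canonBad_Ld_false (hu : ∀ u ∈ units, Nat.Coprime u n) (hC : Canon n K S t) {j : ℕ} (hj : j ≤ K) :
    canonBad (mkTC n K units) (Ld t j) (maskL (Ld t j)) = false := by
  classical
  by_contra h
  rw [Bool.not_eq_false] at h
  obtain ⟨a, ha, u, hu', hclt⟩ := canonBad_true h
  rw [mkTC_units] at hu'
  -- a is the code of some y ∈ S
  obtain ⟨ia, hia, rfl⟩ := (mem_Ld t j a).1 ha
  have haS := (hC.mem (t ia)).2 ⟨ia, by omega, rfl⟩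
  unfold codes at haS; rw [Finset.mem_image] at haS
  obtain ⟨y, hyS, hy⟩ := haS
  -- the sets of the prefix lemma
  set P : Finset ℕ := (Ld t j).toFinset with hP
  set I : Finset ℕ := P.image (gmap n (t ia) u) with hI
  have hIP : CLTset I P :=
    CLTset_of_CLT (fun z => by rw [testBit_imageMask, hI, Finset.mem_image]; simp [hP, eq_comm])
      (fun z => by rw [testBit_maskL, hP]; simp) hclt
  have hX : CLTset ((codes S).image (gmap n (t ia) u)) (codes S) := by
    refine clt_lift (P := P) (fun z hz hzP x hx => ?_) (Finset.image_subset_image fun z hz => ?_) Finset.card_image_le hIP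
    · obtain ⟨i', hi', rfl⟩ := (hC.mem z).1 hz
      rw [hP, List.mem_toFinset, mem_Ld] at hx hzP
      obtain ⟨i, hi, rfl⟩ := hx
      exact hC.mono i i' (by by_contra hc; exact hzP ⟨i', by omega, rfl⟩) hi'
    · rw [hP, List.mem_toFinset, mem_Ld] at hz
      obtain ⟨i, hi, rfl⟩ := hz
      exact (hC.mem _).2 ⟨i, by omega, rfl⟩
  rw [← hy, image_gmap] at hX
  rw [← ZMod.coe_unitOfCoprime u (hu u hu')] at hX
  exact hC.can _ y hX

/-- **ONE T-LEVEL ALONG THE CANONICAL SET**: if the level below `Ld t j` answers `true`, so does the subtree below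
`Ld t (j+1)` (`1 ≤ j < K`). -/
theorem tnode_step (hu : ∀ u ∈ units, Nat.Coprime u n) (hC : Canon n K S t) {j : ℕ} (hj1 : 1 ≤ j) (hjK : j < K)
    (rec : List ℕ → ℕ → Bool) (h : tnode (mkTC n K units) rec (Ld t j) (maskL (Ld t j)) = true) :
    rec (Ld t (j + 1)) (maskL (Ld t (j + 1))) = true := by
  unfold tnode at h
  rw [force_eq] at h
  obtain ⟨j', rfl⟩ : ∃ j', j = j' + 1 := ⟨j - 1, by omega⟩
  have hhead : headL (Ld t (j' + 1)) = t j' := rfl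
  have hcand : (Nat.land (mkTC n K units).fulln (Nat.xor (mkTC n K units).fulln (lowMask (Nat.add (headL (Ld t (j' + 1))) 1)))).testBit
      (t (j' + 1)) = true := by
    rw [hhead, mkTC_fulln, land_eq, xor_eq, add_eq', Nat.testBit_land, Nat.testBit_xor, testBit_lowMask, testBit_lowMask,
      decide_eq_true (hC.lt hjK)]
    have := hC.mono j' (j' + 1) (Nat.lt_succ_self _) hjK
    simp; omega
  have hb := allBits_spec _ _ _ le_rfl h _ hcand
  rw [force_eq, force_eq] at hb
  change (canonBad (mkTC n K units) (Ld t (j' + 1 + 1)) (maskL (Ld t (j' + 1 + 1))) ||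
    rec (Ld t (j' + 1 + 1)) (maskL (Ld t (j' + 1 + 1)))) = true at hb
  rw [canonBad_Ld_false units hu hC (show j' + 1 + 1 ≤ K by omega), Bool.false_or] at hb
  exact hb

/-- `tsearchRoots = true` refutes every listed root. -/
theorem rootSearch_of_tsearchRoots (c : TC) {roots : List (List ℕ)} (h : tsearchRoots c roots = true) :
    ∀ R ∈ roots, rootSearch c R = true := by
  induction roots with
  | nil => intro R hR; simp at hR
  | cons L R ih =>
      rw [tsearchRoots_cons, Bool.and_eq_true] at h
      intro R' hR'
      rcases List.mem_cons.1 hR' with rfl | hR'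
      · exact h.1
      · exact ih h.2 R' hR'

/-- The frontier recursion. -/
noncomputable def frontRec (c : TC) (roots : List (List ℕ)) : ℕ → List ℕ → ℕ → Bool :=
  @Nat.rec (fun _ => List ℕ → ℕ → Bool)
    (fun L _ => @List.rec (List ℕ) (fun _ => Bool) false (fun R _ ih => beqL R L || ih) roots)
    (fun _ ih L PM => tnode c ih L PM)

omit [NeZero n] in
/-- The frontier's base: a `true` lists the prefix. -/
theorem frontRec_zero {c : TC} {roots : List (List ℕ)} {L : List ℕ} {PM : ℕ} (h : frontRec c roots 0 L PM = true) :
    L ∈ roots := by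
  change (@List.rec (List ℕ) (fun _ => Bool) false (fun R _ ih => beqL R L || ih) roots) = true at h
  induction roots with
  | nil => exact absurd h (by simp)
  | cons R rs ih =>
      have h' : (beqL R L || @List.rec (List ℕ) (fun _ => Bool) false (fun R _ ih => beqL R L || ih) rs) = true := h
      rw [Bool.or_eq_true] at h'
      rcases h' with h1 | h2
      · rw [beqL_true h1]; simp
      · exact List.mem_cons_of_mem _ (ih h2)

/-- **THE FRONTIER LISTS THE DEPTH-`J` PREFIX** of the canonical set. -/
theorem frontier_mem (hu : ∀ u ∈ units, Nat.Coprime u n) (hC : Canon n K S t) {J : ℕ} (hJ : 1 ≤ J) (hJK : J ≤ K)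
    {roots : List (List ℕ)} (h : frontierOK (mkTC n K units) J roots = true) : Ld t J ∈ roots := by
  have key : ∀ r j, j + r = J → 1 ≤ j → frontRec (mkTC n K units) roots r (Ld t j) (maskL (Ld t j)) = true → Ld t J ∈ roots := by
    intro r
    induction r with
    | zero => intro j hj _ hr; rw [Nat.add_zero] at hj; subst hj; exact frontRec_zero hr
    | succ r ih =>
        intro j hj hj1 hr
        exact ih (j + 1) (by omega) (by omega) (tnode_step units hu hC hj1 (by omega) _ hr)
  refine key (J - 1) 1 (by omega) le_rfl ?_
  have h1 : Ld t 1 = [0] := by simp [Ld, hC.zero]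
  have h2 : maskL [0] = 1 := rfl
  rw [h1, h2]; exact h

/-- **A `true` SEARCH BELOW THE DEPTH-`J` PREFIX REACHES THE LEAF** of the canonical set: the leaf answered `true`. -/
theorem tleaf_of_roots (hu : ∀ u ∈ units, Nat.Coprime u n) (hC : Canon n K S t) {J : ℕ} (hJ : 1 ≤ J) (hJK : J ≤ K)
    {roots : List (List ℕ)} (hmem : Ld t J ∈ roots) (h : tsearchRoots (mkTC n K units) roots = true) :
    tleaf (mkTC n K units) (Ld t K) (maskL (Ld t K)) = true := by
  have key : ∀ r j, j + r = K → 1 ≤ j → tsearch (mkTC n K units) r (Ld t j) (maskL (Ld t j)) = true →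
      tleaf (mkTC n K units) (Ld t K) (maskL (Ld t K)) = true := by
    intro r
    induction r with
    | zero => intro j hj _ hr; rw [Nat.add_zero] at hj; subst hj; exact hr
    | succ r ih =>
        intro j hj hj1 hr
        exact ih (j + 1) (by omega) (by omega) (tnode_step units hu hC hj1 (by omega) _ hr)
  have hR := rootSearch_of_tsearchRoots _ h _ hmem
  unfold rootSearch at hR
  rw [force_eq, force_eq, mkTC_K, lengthL_Ld] at hR
  exact key (K - J) J (by omega) hJ hR

end TPhase

end STPP211T

end Summit.MatrixMultiplication.OmegaCensus
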